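import Literature.Analysis.FluidPDE.PassiveScalarDiagForcedTraceGlobal
import HarnessLib

/-!
# Restart and trace for the UNFORCED diagonal-diffusion passive scalar class

Analysis/FluidPDE proof-support file (everything proved). The restart / trace layer of
`PassiveScalarDiagForcedTrace`, `PassiveScalarDiagForcedRestart(Global)`, `…TraceGlobal` is stated
for the sourced class `Torus.IsWeakScalarTransportDiagForcedOn`; this file transports it to the
homogeneous class `Torus.IsWeakScalarTransportDiagOn T a κ u θ₀ θ` (`∂ₜθ + u·∇θ = κ ∑ᵢ aᵢ ∂ᵢ∂ᵢθ`,
`AcceleratingDissipationEnhancement`; the binder of `HessChildsRowan2025a_cor13`,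
`HessChildsRowan2025_cor12`) through `isWeakScalarTransportDiagForcedOn_zero_iff` (`s = 0`, the
source terms of the trace identities vanish):

* `IsWeakScalarTransportDiagOn.congr_velocity`, `….mono`, `….intPhase_iff`, `….congr_ae_slice`;
* `IsWeakScalarTransportDiagOn.translate` — restart at `σ ∈ [0,T)` from any datum with the trace
  identities `∫ θσ g = ∫ θ₀ g + ∫_{(0,σ]} ∫ θ (⟪u,∇g⟫ + κ ∑ᵢ aᵢ ∂ᵢ∂ᵢ g)`;
* `IsWeakScalarTransportDiagOn.exists_weaklyContinuous_representative` (finite horizon) and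
  `Torus.exists_weaklyContinuous_representative_of_forall_isWeakScalarTransportDiagOn` (global:
  one `C([0,∞); L²_w)` representative which is a solution and restarts from its own slices at
  every `σ ≥ 0`).

## References

* R. J. DiPerna, P.-L. Lions, Invent. Math. 98 (1989), §II.1, (12)–(14), §II.3. [`DiPernaLions1989`]
* C. De Lellis, L. Székelyhidi Jr., Arch. Ration. Mech. Anal. 195 (2010), Lemma 7.1. [`DeLellisSzekelyhidi2010`]
-/

noncomputable section

open _root_.MeasureTheory _root_.Set _root_.Filter _root_.Function _root_.TopologicalSpace
open scoped ENNReal NNReal InnerProductSpace ContDiff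

namespace Literature.Analysis.FluidPDE

namespace Torus

open Literature.Analysis.FunctionSpaces.Torus Literature.Analysis.FunctionSpaces

variable {d : Type*} [Fintype d] [DecidableEq d]

omit [Fintype d] [DecidableEq d] in
/-- Two functions continuous on `[0,T]` that agree for a.e. `t ∈ (0,T)` agree on `[0,T]`
(`T > 0`). [folklore] -/
private theorem eqOn_Icc_of_ae_Ioo_aux {Y : Type*} [TopologicalSpace Y] [T2Space Y] {T : ℝ}
    (hT : 0 < T) {f g : ℝ → Y} (hf : ContinuousOn f (Icc 0 T)) (hg : ContinuousOn g (Icc 0 T))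
    (h : ∀ᵐ t ∂(volume.restrict (Ioo 0 T)), f t = g t) : EqOn f g (Icc 0 T) := by
  refine Measure.eqOn_Icc_of_ae_eq (μ := volume) hT.ne ?_ hf hg
  have e : (volume : Measure ℝ).restrict (Icc 0 T) = volume.restrict (Ioo 0 T) :=
    Measure.restrict_congr_set Ioo_ae_eq_Icc.symm
  rw [e]
  exact h

namespace IsWeakScalarTransportDiagOn

variable {T κ : ℝ} {a : d → ℝ} {u : ℝ → UnitAddTorus d → EuclideanSpace ℝ d}
  {θ₀ : UnitAddTorus d → ℝ} {θ : ℝ → UnitAddTorus d → ℝ}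

/-! ## Bookkeeping -/

/-- The homogeneous weak notion only sees the drift on `(0,T)`. [cite: DiPernaLions1989, §II.1 (12)–(14)] -/
theorem congr_velocity {u' : ℝ → UnitAddTorus d → EuclideanSpace ℝ d}
    (huu' : ∀ t ∈ Ioo 0 T, u' t = u t) (h : IsWeakScalarTransportDiagOn T a κ u θ₀ θ) :
    IsWeakScalarTransportDiagOn T a κ u' θ₀ θ :=
  isWeakScalarTransportDiagForcedOn_zero_iff.1
    ((isWeakScalarTransportDiagForcedOn_zero_iff.2 h).congr_velocity huu')

/-- Shrinking the horizon. [cite: DiPernaLions1989, §II.1 (12)–(14)] -/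
theorem mono {T' : ℝ} (h : IsWeakScalarTransportDiagOn T a κ u θ₀ θ) (hT' : T' ≤ T) :
    IsWeakScalarTransportDiagOn T' a κ u θ₀ θ :=
  isWeakScalarTransportDiagForcedOn_zero_iff.1 ((isWeakScalarTransportDiagForcedOn_zero_iff.2 h).mono hT')

/-- **Integer periods see the same weak solutions** (homogeneous class): for a drift `L`-periodic
on `t ≥ 0` (`L ≥ 0`), the phase-`nL` drift has the same weak solutions as the phase-`0` drift;
e.g. the estimates of `HessChildsRowan2025a_cor13` transfer to every integer multiple of the
period. [cite: DiPernaLions1989, §II.1 (12)–(14)] -/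
theorem intPhase_iff {L : ℝ} (hL : 0 ≤ L) (hu : ∀ t : ℝ, 0 ≤ t → u (t + L) = u t) (n : ℕ) :
    IsWeakScalarTransportDiagOn T a κ (fun t => u (n * L + t)) θ₀ θ ↔ IsWeakScalarTransportDiagOn T a κ u θ₀ θ := by
  rw [← isWeakScalarTransportDiagForcedOn_zero_iff, ← isWeakScalarTransportDiagForcedOn_zero_iff (u := u)]
  exact IsWeakScalarTransportDiagForcedOn.intPhase_iff_of_steady (S := (0 : UnitAddTorus d → ℝ)) hL hu n

/-- Modification on null sets of times (homogeneous class). [cite: DiPernaLions1989, §II.1 (12)–(14)] -/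
theorem congr_ae_slice {θ' : ℝ → UnitAddTorus d → ℝ} (h : IsWeakScalarTransportDiagOn T a κ u θ₀ θ)
    (hm : AEStronglyMeasurable (stLift θ') (volume.restrict (Ioo 0 T ×ˢ univ)))
    (hae : ∀ᵐ t ∂(volume.restrict (Ioo 0 T)), θ' t =ᵐ[volume] θ t) :
    IsWeakScalarTransportDiagOn T a κ u θ₀ θ' :=
  isWeakScalarTransportDiagForcedOn_zero_iff.1
    ((isWeakScalarTransportDiagForcedOn_zero_iff.2 h).congr_ae_slice hm hae)

/-! ## Restart and trace -/

/-- **Restart from a trace datum** (homogeneous class): for `0 ≤ σ < T` and `θσ` with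
`∫ θσ g = ∫ θ₀ g + ∫_{(0,σ]} ∫ θ(τ) (⟪u(τ), ∇g⟫ + κ ∑ᵢ aᵢ ∂ᵢ∂ᵢ g) dτ` for every smooth `g`, the
translate `t ↦ θ(σ + t)` is a weak solution on `[0, T - σ)` with drift `u(σ + ·)` and datum
`θσ`. [cite: DiPernaLions1989, §II.1 (12)–(14)] -/
theorem translate (h : IsWeakScalarTransportDiagOn T a κ u θ₀ θ) {σ : ℝ} (hσ : 0 ≤ σ) (hσT : σ < T)
    {θσ : UnitAddTorus d → ℝ}
    (htr : ∀ g : UnitAddTorus d → ℝ, IsSmooth g →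
      ∫ x, θσ x * g x = (∫ x, θ₀ x * g x) +
        ∫ τ in Ioc 0 σ, ∫ x, θ τ x * (⟪u τ x, gradient g x⟫_ℝ +
          κ * ∑ i, a i * FunctionSpaces.Torus.partialDeriv i (FunctionSpaces.Torus.partialDeriv i g) x)) :
    IsWeakScalarTransportDiagOn (T - σ) a κ (fun t => u (σ + t)) θσ (fun t => θ (σ + t)) := by
  have h' := isWeakScalarTransportDiagForcedOn_zero_iff.2 h
  have key := h'.translate hσ hσT (θσ := θσ) fun g hg => by
    rw [htr g hg]
    simp only [Pi.zero_apply, zero_mul, integral_zero, add_zero]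
  exact isWeakScalarTransportDiagForcedOn_zero_iff.1 key

/-- **The `C([0,T]; L²_w)` representative and its restarts** (homogeneous class, `T > 0`): a
field `w` with `w(t) ∈ L²`, `∫ w(t)² ≤ C`, `w(t) = θ(t)` a.e. for a.e. `t ∈ (0,T)`, `t ↦ ∫ w(t) g`
continuous on `[0,T]` for `g ∈ L²`, the trace identities at every `σ ∈ [0,T]`, `w` a weak
solution from `θ₀`, and `t ↦ w(σ + t)` a weak solution on `[0, T - σ)` from `w(σ)` for every
`σ ∈ [0,T)`. [cite: DeLellisSzekelyhidi2010, Lemma 7.1] -/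
theorem exists_weaklyContinuous_representative [Nonempty d] (hT : 0 < T)
    (h : IsWeakScalarTransportDiagOn T a κ u θ₀ θ) :
    ∃ w : ℝ → UnitAddTorus d → ℝ,
      AEStronglyMeasurable (stLift w) (volume.restrict (Ioi 0 ×ˢ univ)) ∧
      (∀ t, 0 ≤ t → MemLp (w t) 2 volume) ∧
      (∃ C : ℝ≥0, ∀ t, 0 ≤ t → ∫ x, w t x ^ 2 ≤ C) ∧
      (∀ᵐ t ∂(volume.restrict (Ioo 0 T)), w t =ᵐ[volume] θ t) ∧
      (∀ g : UnitAddTorus d → ℝ, MemLp g 2 volume →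
        ContinuousOn (fun t => ∫ x, w t x * g x) (Icc 0 T)) ∧
      (∀ g : UnitAddTorus d → ℝ, IsSmooth g → ∀ σ ∈ Icc 0 T,
        ∫ x, w σ x * g x = (∫ x, θ₀ x * g x) +
          ∫ τ in Ioc 0 σ, ∫ x, θ τ x * (⟪u τ x, gradient g x⟫_ℝ +
            κ * ∑ i, a i * FunctionSpaces.Torus.partialDeriv i (FunctionSpaces.Torus.partialDeriv i g) x)) ∧
      IsWeakScalarTransportDiagOn T a κ u θ₀ w ∧
      ∀ σ ∈ Ico 0 T, IsWeakScalarTransportDiagOn (T - σ) a κ (fun t => u (σ + t)) (w σ)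
        (fun t => w (σ + t)) := by
  have h' := isWeakScalarTransportDiagForcedOn_zero_iff.2 h
  obtain ⟨w, hwm, hw2, hwC, hae, hwc, hsol, hrest⟩ := h'.exists_representative_solution hT
  obtain ⟨w', -, -, -, hae', hwc', htr'⟩ := h'.exists_weaklyContinuous_representative hT
  refine ⟨w, hwm, hw2, hwC, hae, hwc, fun g hg σ hσ => ?_, isWeakScalarTransportDiagForcedOn_zero_iff.1 hsol,
    fun σ hσ => isWeakScalarTransportDiagForcedOn_zero_iff.1 (hrest σ hσ)⟩
  -- the two representatives have the same (continuous) pairings, so the trace identities transfer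
  have hEq : EqOn (fun t => ∫ x, w t x * g x) (fun t => ∫ x, w' t x * g x) (Icc 0 T) := by
    refine eqOn_Icc_of_ae_Ioo_aux (Y := ℝ) hT (hwc g (hg.memLp 2)) (hwc' g (hg.memLp 2)) ?_
    filter_upwards [hae, hae'] with t ht ht'
    exact integral_congr_ae ((ht.trans ht'.symm).mono fun x hx => by simp only [hx])
  have key := hEq hσ
  simp only at key
  rw [key, htr' g hg σ hσ]
  simp only [Pi.zero_apply, zero_mul, integral_zero, add_zero]

end IsWeakScalarTransportDiagOn

/-! ## Global homogeneous solutions -/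

/-- **The `C([0,∞); L²_w)` representative of a global homogeneous weak solution and its
restarts**: for `θ` a weak solution of `∂ₜθ + u·∇θ = κ ∑ᵢ aᵢ ∂ᵢ∂ᵢθ` on `T^d × [0,T)` for every
`T > 0`, there is ONE field `w` on `[0,∞)` with `w(t) ∈ L²`, `w(t) = θ(t)` a.e. for a.e. `t > 0`,
`t ↦ ∫ w(t) g` continuous on `[0,∞)` for `g ∈ L²`, the trace identities
`∫ w(σ) g = ∫ θ₀ g + ∫_{(0,σ]} ∫ θ (⟪u,∇g⟫ + κ ∑ᵢ aᵢ ∂ᵢ∂ᵢ g)` at EVERY `σ ≥ 0`, `w` again a weak solution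
from `θ₀` on every `[0,T)`, and `t ↦ w(σ + t)` a weak solution on every `[0,T)` from `w(σ)`
with drift `u(σ + ·)`, for EVERY `σ ≥ 0`
(`IsWeakScalarTransportDiagForced.exists_weaklyContinuous_representative` with `s = 0`).
[cite: DeLellisSzekelyhidi2010, Lemma 7.1] -/
theorem exists_weaklyContinuous_representative_of_forall_isWeakScalarTransportDiagOn [Nonempty d]
    {κ : ℝ} {a : d → ℝ} {u : ℝ → UnitAddTorus d → EuclideanSpace ℝ d} {θ₀ : UnitAddTorus d → ℝ}
    {θ : ℝ → UnitAddTorus d → ℝ} (h : ∀ T : ℝ, 0 < T → IsWeakScalarTransportDiagOn T a κ u θ₀ θ) :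
    ∃ w : ℝ → UnitAddTorus d → ℝ,
      AEStronglyMeasurable (stLift w) (volume.restrict (Ioi 0 ×ˢ univ)) ∧
      (∀ t, 0 ≤ t → MemLp (w t) 2 volume) ∧
      (∀ T : ℝ, ∃ C : ℝ≥0, ∀ t ∈ Icc 0 T, ∫ x, w t x ^ 2 ≤ C) ∧
      (∀ᵐ t ∂(volume.restrict (Ioi 0)), w t =ᵐ[volume] θ t) ∧
      (∀ g : UnitAddTorus d → ℝ, MemLp g 2 volume →
        ContinuousOn (fun t => ∫ x, w t x * g x) (Ici 0)) ∧
      (∀ g : UnitAddTorus d → ℝ, IsSmooth g → ∀ σ, 0 ≤ σ →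
        ∫ x, w σ x * g x = (∫ x, θ₀ x * g x) +
          ∫ τ in Ioc 0 σ, ∫ x, θ τ x * (⟪u τ x, gradient g x⟫_ℝ +
            κ * ∑ i, a i * FunctionSpaces.Torus.partialDeriv i (FunctionSpaces.Torus.partialDeriv i g) x)) ∧
      (∀ T : ℝ, 0 < T → IsWeakScalarTransportDiagOn T a κ u θ₀ w) ∧
      ∀ σ, 0 ≤ σ → ∀ T : ℝ, 0 < T →
        IsWeakScalarTransportDiagOn T a κ (fun t => u (σ + t)) (w σ) (fun t => w (σ + t)) := by
  have h' : IsWeakScalarTransportDiagForced a κ u 0 θ₀ θ := isWeakScalarTransportDiagForced_zero_iff.2 h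
  obtain ⟨w, hwm, hw2, hwC, hae, hwc, htr, hsol, hrest⟩ := h'.exists_weaklyContinuous_representative
  refine ⟨w, hwm, hw2, hwC, hae, hwc, fun g hg σ hσ => ?_, isWeakScalarTransportDiagForced_zero_iff.1 hsol,
    fun σ hσ => isWeakScalarTransportDiagForced_zero_iff.1 (hrest σ hσ)⟩
  rw [htr g hg σ hσ]
  simp only [Pi.zero_apply, zero_mul, integral_zero, add_zero]

end Torus

end Literature.Analysis.FluidPDE

end
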